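import Mathlib
import Literature.LinearAlgebra.Matrix.MaximalVolumeErrorBounds

/-!
# ε-rank bounds for unfoldings of function samples from smoothness (QTT / two-scale lemma)

Why a SMOOTH function sampled on a fine dyadic (`b`-adic) grid has small quantics-tensor-train
(QTT) bond ranks up to a small entrywise error — the a-priori justification of rank-revealing
quantics constructions (TT-cross / TCI on function tensors).  Everything here is elementary
linear algebra plus Taylor's theorem; no singular values are used.

THE OBJECT.  The `m`-th unfolding of the quantics tensor of `f : [0,1] → ℝ` is the matrix
`(x, y) ↦ f(x + y)` whose rows are the coarse grid points `x = a_i` (the first `m` digits) and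
whose columns are the fine offsets `y = y_j ∈ [0, b^{-m})` (the remaining digits): a
TWO-SCALE MATRIX `A i j = f (a i + y j)`.  More generally (Grasedyck's "vector-tensorization")
the rows of any TT-unfolding of a reshaped sample vector are the CONTIGUOUS SUB-VECTORS of the
vector [Grasedyck2010, Thm. 11], here `Matrix.of fun i j => v (finProdFinEquiv (i, j))`,
entry `v (j + L * i)`.

THE IDIOM.  "`A` is within `ε` of rank `≤ r`" is spelled out as
`∃ X, X.rank ≤ r ∧ ∀ i j, |A i j - X i j| ≤ ε` (Lindsey's `(ε,∞)`-rank `≤ r`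
[Lindsey2023, §3.1 p. 6]); this is verbatim the hypothesis `hF/hδ` of the maximal-volume error
bound `Literature.LinearAlgebra.Matrix.abs_sub_crossInterp_le_of_volume_maximal` and the
hypothesis `hlow` of the TCI a-priori bound
`Literature.LinearAlgebra.TensorNetworks.TCIPivots.abs_sub_tciEval_le_of_unfoldings_volume_maximal`
(whose unfoldings are `Matrix.of fun x y => F (x.1 ++ y.1)`, cf. the digit-string form
`exists_rank_le_succ_of_contDiffAt_append` below).

RESULTS.
* `rank_le_finrank_of_forall_row_mem`, `rank_le_card_of_eq_sum_mul`: if all rows lie in a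
  common subspace `V` (are combinations of `#κ` fixed row vectors) then `rank ≤ dim V`
  (`≤ #κ`) — [Grasedyck2010, Thm. 11 ("bounded by dim V_q")]; approximate version
  `exists_rank_le_card_of_abs_sub_sum_mul_le` = [Lindsey2023, Lemma 1] (rows approximable to
  accuracy `ε` in a common `(N+1)`-dimensional space ⇒ `(ε,∞)`-rank `≤ N+1`).
* `exists_rank_le_add_card_of_rows` — THE EXCEPTIONAL-ROWS DEVICE of
  [Grasedyck2010, Thm. 18, proof step 2]: approximate the rows in a set `P` within `ε` by rank
  `≤ r` and KEEP THE OTHER ROWS EXACT: within `ε` of rank `≤ r + #{i | ¬ P i}` ("rank ≤ p+1+2m"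
  for `2m` sub-vectors next to `m` singular points); `exists_rank_le_add_of_add`,
  `exists_rank_le_submatrix`, `exists_rank_le_transpose`: closure under sums, restriction,
  transposition.
* `rank_le_succ_of_eval_polynomial`, `rank_le_succ_of_polynomial_eval_add`,
  `rank_reshape_le_succ_of_polynomial`: rows that are polynomials of degree `≤ p` evaluated at
  COMMON nodes have rank `≤ p+1`; in particular `(f(a_i + y_j))` for a polynomial `f` of degree
  `≤ p` and ANY nodes, and every two-level reshape of the samples of `f` on an equispaced grid —
  [Grasedyck2010, Cor. 13], [Khoromskij2015, §1.2 ("r ≤ m+1 for polynomials of degree m")],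
  [AliNouy2023, Part II Lemma 4.1 (arXiv:2007.00128)].
* `exists_rank_le_succ_of_contDiffAt` (THE SMOOTHNESS BOUND): if `f` is `C^{p+1}` near every
  cell `[a_i, a_i + η]`, `|f^{(p+1)}| ≤ M` there and `y_j ∈ [0, η]`, then `(f(a_i + y_j))` is
  within `M η^{p+1} / (p+1)!` of rank `≤ p+1` (row-wise Taylor polynomials at `a_i` — all in the
  span of `1, y, …, y^p` — with the Lagrange remainder); `…_of_contDiff` the global version,
  `exists_rank_le_succ_add_card_of_contDiffAt` the version with exceptional (singular) rows
  [Grasedyck2010, Thm. 18], `exists_rank_le_succ_reshape_of_contDiff` the equispaced-grid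
  reshape (`η = L δ`: at QTT bond `m`, `η = b^{-m}` and the error decays like `b^{-m(p+1)}`), and
  `exists_rank_le_succ_of_contDiffAt_append` the digit-string form under the self-similarity law
  `pt (x ++ y) = pt x + θ · pt y`.  This is the Taylor-polynomial variant of
  [Lindsey2023, Prop. 2] (there: Chebyshev–Lobatto interpolation of the fine variable, constant
  `(4C/π) 2^{-m} / (p (N-p)^p)`; here: Taylor expansion in the fine variable, constant
  `C η^{p+1}/(p+1)!` with `N = p`), and of [Grasedyck2010, Thm. 18, proof step 1].
* `abs_sub_crossInterp_le_of_contDiffAt_of_volume_maximal`: composed with the maximal-volume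
  quasi-optimality bound (anchor `MaximalVolumeErrorBounds`), a `(p+1)`-pivot maximal-volume
  cross interpolation of the two-scale matrix of a `C^{p+1}` function has entrywise error
  `≤ (p+2)² · M η^{p+1}/(p+1)!`.

NOT FORMALISED: the `log₂(1/ε)`-degree choice and the asymptotic-smoothness constants of
[Grasedyck2010, Thm. 18] (best polynomial approximation of asymptotically smooth functions,
proof of Thm. 18 via Börm–Löhndorf–Melenk 2005, Lemma 3.13); the Chebyshev-interpolation
constants of [Lindsey2023, Prop. 2], the Bernstein-ellipse / analytic bound
[Lindsey2023, Prop. 5] and the band-limited bound [Lindsey2023, Prop. 8, Cor. 10]; the `L^p`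
tensorisation framework and Sobolev/Besov rates of [AliNouy2023]; any singular-value
(`(ε,2)`-rank) statement.

AI-produced formalisation (H21 engines group, seat eng-quad-2, 2026-08-22); no facts, no axioms
beyond Mathlib's, no `sorry`.
-/

open Matrix Finset Set
open scoped Nat

namespace Literature.LinearAlgebra.TensorNetworks

/-! ## Rank of a matrix whose rows lie in a common small space -/

section RowSpace

variable {K : Type*} [Field K] {m n κ : Type*} [Fintype n] [Fintype κ]

/-- [folklore] Sub-additivity of matrix rank (bookkeeping; Mathlib has the linear-map form). -/
private theorem rank_add_le_aux (A B : Matrix m n K) : (A + B).rank ≤ A.rank + B.rank := by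
  unfold Matrix.rank
  rw [Matrix.mulVecLin_add]
  exact (Submodule.finrank_mono (LinearMap.range_add_le _ _)).trans
    (Submodule.finrank_add_le_finrank_add_finrank _ _)

/-- RANK OF A MATRICIZATION = DIMENSION OF THE SPAN OF ITS SUB-VECTORS, the usable half: if every
row of `A` (every contiguous sub-vector `x|_{I_{ℓ,q}}` of the tensorised vector) lies in a
subspace `V_q`, "then the rank of the matricization is bounded by `dim V_q`".
[cite: Grasedyck2010, Thm. 11] -/
theorem rank_le_finrank_of_forall_row_mem [Fintype m] (A : Matrix m n K)
    (V : Submodule K (n → K)) (hV : ∀ i, A i ∈ V) : A.rank ≤ Module.finrank K V := by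
  rw [rank_eq_finrank_span_row]
  refine Submodule.finrank_mono (Submodule.span_le.mpr ?_)
  rintro _ ⟨i, rfl⟩
  exact hV i

/-- Coordinate form of [Grasedyck2010, Thm. 11]: if every row of `A` is a linear combination of
`#κ` fixed row vectors `w k` (`A i j = Σ_k c i k · w k j`, i.e. `A = C W`), then `rank A ≤ #κ`.
This is the form in which all rank bounds below are obtained ("the interpolation maps the
`p+1`-dimensional space of polynomials … to an at most `p+1` dimensional vector space `V_q`",
[Grasedyck2010, proof of Cor. 13]).  [cite: Grasedyck2010, Thm. 11 and proof of Cor. 13] -/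
theorem rank_le_card_of_eq_sum_mul (A : Matrix m n K) (c : m → κ → K) (w : κ → n → K)
    (hA : ∀ i j, A i j = ∑ k, c i k * w k j) : A.rank ≤ Fintype.card κ := by
  have h : A = Matrix.of c * Matrix.of w := by
    ext i j
    simp [Matrix.mul_apply, hA]
  rw [h]
  exact (rank_mul_le_left _ _).trans (rank_le_card_width _)

/-- [folklore] Scattering the rows of `B` into a larger row index type along `f` (rows not hit
are zero) does not increase the rank: the scattered matrix is `E * B` with a `0/1` matrix `E`
(bookkeeping). -/
private theorem rank_scatter_le [DecidableEq m] {ι : Type*} [Fintype ι] (f : ι → m)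
    (B : Matrix ι n K) :
    (Matrix.of fun i j => ∑ k, if f k = i then B k j else 0).rank ≤ B.rank := by
  have h : (Matrix.of fun i j => ∑ k, if f k = i then B k j else 0) =
      (Matrix.of fun i k => if f k = i then (1 : K) else 0) * B := by
    ext i j
    simp only [Matrix.mul_apply, Matrix.of_apply, ite_mul, one_mul, zero_mul]
  rw [h]
  exact rank_mul_le_right _ _

/-- [folklore] The scattered matrix has rank at most the number of scattered rows
(bookkeeping). -/
private theorem rank_scatter_le_card [DecidableEq m] {ι : Type*} [Fintype ι] (f : ι → m)
    (B : Matrix ι n K) :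
    (Matrix.of fun i j => ∑ k, if f k = i then B k j else 0).rank ≤ Fintype.card ι := by
  have h : (Matrix.of fun i j => ∑ k, if f k = i then B k j else 0) =
      (Matrix.of fun i k => if f k = i then (1 : K) else 0) * B := by
    ext i j
    simp only [Matrix.mul_apply, Matrix.of_apply, ite_mul, one_mul, zero_mul]
  rw [h]
  exact (rank_mul_le_left _ _).trans (rank_le_card_width _)

/-- [folklore] Evaluation of a sum over a subtype of a single-point indicator (bookkeeping). -/
private theorem sum_subtype_ite_eq [Fintype m] [DecidableEq m] (P : m → Prop)
    [DecidablePred P] (g : {k // P k} → K) (i : m) :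
    (∑ k : {k // P k}, if (k : m) = i then g k else 0) = if h : P i then g ⟨i, h⟩ else 0 := by
  by_cases hi : P i
  · rw [dif_pos hi, Finset.sum_eq_single ⟨i, hi⟩]
    · simp
    · intro k _ hk
      exact if_neg fun e => hk (Subtype.ext e)
    · intro h
      exact absurd (Finset.mem_univ _) h
  · rw [dif_neg hi]
    exact Finset.sum_eq_zero fun k _ => if_neg fun e : (k : m) = i => hi (e ▸ k.2)

end RowSpace

/-! ## The "within `ε` of rank `≤ r`" idiom: closure properties -/

section Approx

variable {K : Type*} [Field K] [LinearOrder K] [IsStrictOrderedRing K]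
variable {m n κ : Type*} [Fintype n] [Fintype κ]

omit [IsStrictOrderedRing K] in
/-- `(ε,∞)`-RANK FROM ROW-WISE APPROXIMATION IN A COMMON SPACE [Lindsey2023, Lemma 1, in
coordinates]: if every entry of `A` is within `ε` of `Σ_k c i k · w k j` for `#κ` FIXED row
vectors `w k` (e.g. the fine-grid values of `1, y, …, y^N`, `#κ = N+1`, the coefficients `c i ·`
depending on the row = coarse point only), then `A` is within `ε` of a matrix of rank `≤ #κ`
("suppose `E_{m,N}[f] ≤ ε`; then the `(ε,∞)` rank of the `m`-th unfolding matrix is at most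
`N+1`").  [cite: Lindsey2023, Lemma 1] -/
theorem exists_rank_le_card_of_abs_sub_sum_mul_le (A : Matrix m n K) (c : m → κ → K)
    (w : κ → n → K) {ε : K} (h : ∀ i j, |A i j - ∑ k, c i k * w k j| ≤ ε) :
    ∃ X : Matrix m n K, X.rank ≤ Fintype.card κ ∧ ∀ i j, |A i j - X i j| ≤ ε :=
  ⟨Matrix.of fun i j => ∑ k, c i k * w k j,
    rank_le_card_of_eq_sum_mul _ c w fun _ _ => rfl, fun i j => h i j⟩

/-- THE EXCEPTIONAL-ROWS DEVICE [Grasedyck2010, Thm. 18, proof step 2]: if the rows of `A` in a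
set `P` are within `ε` of a matrix `X₀` of rank `≤ r`, then — keeping the remaining rows EXACT
("except for the small sets where one can simply use the function `f`") — the whole of `A` is
within `ε` of a matrix of rank `≤ r + #{i | ¬ P i}` ("there are at most `2m` vectors where the
polynomial approximation is not applied.  Thus the dimension of the total span is at most
`rank ≤ p + 1 + 2m`").  [cite: Grasedyck2010, Thm. 18 (proof, step 2)] -/
theorem exists_rank_le_add_card_of_rows [Fintype m] (A : Matrix m n K) (P : m → Prop)
    [DecidablePred P] {r : ℕ} {ε : K} (hε : 0 ≤ ε) (X₀ : Matrix {i // P i} n K)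
    (hX₀ : X₀.rank ≤ r) (h : ∀ (i : {i // P i}) (j : n), |A i j - X₀ i j| ≤ ε) :
    ∃ X : Matrix m n K, X.rank ≤ r + Fintype.card {i // ¬ P i} ∧ ∀ i j, |A i j - X i j| ≤ ε := by
  classical
  let X₁ : Matrix m n K :=
    Matrix.of fun i j => ∑ k : {k // P k}, if (k : m) = i then X₀ k j else 0
  let X₂ : Matrix m n K :=
    Matrix.of fun i j => ∑ k : {k // ¬ P k}, if (k : m) = i then A k j else 0
  have h1 : X₁.rank ≤ r := (rank_scatter_le _ _).trans hX₀
  have h2 : X₂.rank ≤ Fintype.card {i // ¬ P i} := rank_scatter_le_card _ _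
  refine ⟨X₁ + X₂, (rank_add_le_aux _ _).trans (add_le_add h1 h2), fun i j => ?_⟩
  simp only [X₁, X₂, Matrix.add_apply, Matrix.of_apply, sum_subtype_ite_eq]
  by_cases hi : P i
  · simpa [hi] using h ⟨i, hi⟩ j
  · simpa [hi] using hε

/-- Closure under sums: within `ε` of rank `≤ r` plus within `δ` of rank `≤ s` is within `ε + δ`
of rank `≤ r + s` (entrywise triangle inequality and sub-additivity of rank; the `(ε,∞)`
counterpart of exact TT-rank additivity under addition).  [cite: Lindsey2023, §3.1 (definition
of the (ε,p)-rank, p. 6)] -/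
theorem exists_rank_le_add_of_add (A B : Matrix m n K) {r s : ℕ} {ε δ : K}
    (hA : ∃ X : Matrix m n K, X.rank ≤ r ∧ ∀ i j, |A i j - X i j| ≤ ε)
    (hB : ∃ Y : Matrix m n K, Y.rank ≤ s ∧ ∀ i j, |B i j - Y i j| ≤ δ) :
    ∃ Z : Matrix m n K, Z.rank ≤ r + s ∧ ∀ i j, |(A + B) i j - Z i j| ≤ ε + δ := by
  obtain ⟨X, hX, hXe⟩ := hA
  obtain ⟨Y, hY, hYe⟩ := hB
  refine ⟨X + Y, (rank_add_le_aux _ _).trans (add_le_add hX hY), fun i j => ?_⟩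
  rw [Matrix.add_apply, Matrix.add_apply,
    show A i j + B i j - (X i j + Y i j) = (A i j - X i j) + (B i j - Y i j) by ring]
  exact (abs_add_le _ _).trans (add_le_add (hXe i j) (hYe i j))

omit [IsStrictOrderedRing K] in
/-- Closure under restriction: a submatrix (any maps of the index types) of a matrix within `ε`
of rank `≤ r` is within `ε` of rank `≤ r`.  [cite: Lindsey2023, §3.1 (definition of the
(ε,p)-rank, p. 6)] -/
theorem exists_rank_le_submatrix {m' n' : Type*} [Fintype n'] (A : Matrix m n K) {r : ℕ}
    {ε : K} (e : m' → m) (f : n' → n)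
    (hA : ∃ X : Matrix m n K, X.rank ≤ r ∧ ∀ i j, |A i j - X i j| ≤ ε) :
    ∃ X : Matrix m' n' K, X.rank ≤ r ∧ ∀ i j, |A.submatrix e f i j - X i j| ≤ ε := by
  obtain ⟨X, hX, hXe⟩ := hA
  exact ⟨X.submatrix e f, (rank_submatrix_le X e f).trans hX, fun i j => hXe (e i) (f j)⟩

omit [IsStrictOrderedRing K] in
/-- Closure under transposition (the unfoldings of a tensor and of its digit-reversal are
transposes of each other).  [cite: Lindsey2023, §3.1 (definition of the (ε,p)-rank, p. 6)] -/
theorem exists_rank_le_transpose [Fintype m] (A : Matrix m n K) {r : ℕ} {ε : K}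
    (hA : ∃ X : Matrix m n K, X.rank ≤ r ∧ ∀ i j, |A i j - X i j| ≤ ε) :
    ∃ X : Matrix n m K, X.rank ≤ r ∧ ∀ j i, |Aᵀ j i - X j i| ≤ ε := by
  obtain ⟨X, hX, hXe⟩ := hA
  exact ⟨Xᵀ, (rank_transpose X).le.trans hX, fun j i => hXe i j⟩

end Approx

/-! ## Polynomial rows at common nodes: exact rank `≤ p + 1` -/

section PolynomialRows

variable {K : Type*} [Field K] {m n : Type*} [Fintype n]

/-- ROWS THAT ARE POLYNOMIALS OF DEGREE `≤ p` AT COMMON NODES: if `A i j = q_i(y_j)` with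
`deg q_i ≤ p` ("the polynomials are different, but the nodal points are the same"), then
`rank A ≤ p + 1` (`A = C · V` with the coefficient matrix `C` and the `(p+1) × n` Vandermonde-type
matrix `V k j = y_j^k`).  [cite: Grasedyck2010, Cor. 13 (proof)] -/
theorem rank_le_succ_of_eval_polynomial (A : Matrix m n K) (q : m → Polynomial K) (y : n → K)
    {p : ℕ} (hq : ∀ i, (q i).natDegree ≤ p) (hA : ∀ i j, A i j = (q i).eval (y j)) :
    A.rank ≤ p + 1 := by
  have h := rank_le_card_of_eq_sum_mul A (fun i (k : Fin (p + 1)) => (q i).coeff k)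
    (fun k j => y j ^ (k : ℕ)) fun i j => by
      rw [hA, Polynomial.eval_eq_sum_range' (Nat.lt_succ_of_le (hq i)),
        Finset.sum_range (fun k => (q i).coeff k * y j ^ k)]
  simpa using h

/-- THE TWO-SCALE MATRIX OF A POLYNOMIAL: for a polynomial `f` of degree `≤ p` and ANY coarse
nodes `a_i` and fine offsets `y_j`, the matrix `(f(a_i + y_j))_{i,j}` has rank `≤ p + 1` (each row
is the shifted polynomial `f(a_i + ·)`, again of degree `≤ p`, at the common nodes `y_j`) — the
mechanism behind "QTT rank `≤ m + 1` for polynomials of degree `m`" [Khoromskij2015, §1.2] and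
`r_{ν,d}(φ) ≤ min{m̄+1, b^ν}` [AliNouy2023, Part II Lemma 4.1]; cf. the exact TT representation
`TensorTrain.eval_uniform_binomShift` of `QuanticsTensorTrain`.
[cite: Grasedyck2010, Cor. 13][cite: Khoromskij2015, §1.2] -/
theorem rank_le_succ_of_polynomial_eval_add (f : Polynomial K) {p : ℕ} (hf : f.natDegree ≤ p)
    (a : m → K) (y : n → K) (A : Matrix m n K) (hA : ∀ i j, A i j = f.eval (a i + y j)) :
    A.rank ≤ p + 1 :=
  rank_le_succ_of_eval_polynomial A (fun i => Polynomial.taylor (a i) f) y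
    (fun i => (Polynomial.natDegree_taylor _ _).le.trans hf) fun i j => by
      rw [hA, Polynomial.taylor_eval, add_comm]

/-- [Grasedyck2010, Cor. 13] VERBATIM (the TT case): the two-level reshape
`(i, j) ↦ v_{j + L i}` (`i < M` the coarse = slow index, `j < L` the position inside the `i`-th
contiguous sub-vector) of the samples `v_s = f(x₀ + s δ)` of a polynomial of degree `≤ p` on an
EQUISPACED grid has rank `≤ p + 1` ("for every `ℓ` the sub-vector … is the discrete evaluation of
some polynomial (shifted `f`) of degree `p` in the same `N_q` nodes").  For the base-`b` quantics
tensor with `R` digits this is the unfolding at bond `m` (`M = b^m`, `L = b^{R-m}`).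
[cite: Grasedyck2010, Cor. 13] -/
theorem rank_reshape_le_succ_of_polynomial {M L : ℕ} (f : Polynomial K) {p : ℕ}
    (hf : f.natDegree ≤ p) (x₀ δ : K) (v : Fin (M * L) → K)
    (hv : ∀ s, v s = f.eval (x₀ + (s : ℕ) * δ)) :
    (Matrix.of fun (i : Fin M) (j : Fin L) => v (finProdFinEquiv (i, j))).rank ≤ p + 1 :=
  rank_le_succ_of_polynomial_eval_add f hf (fun i : Fin M => x₀ + (L : K) * (i : ℕ) * δ)
    (fun j : Fin L => ((j : ℕ) : K) * δ) _ fun i j => by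
      rw [Matrix.of_apply, hv, finProdFinEquiv_apply_val]
      congr 1
      push_cast
      ring

end PolynomialRows

/-! ## Smooth rows: Taylor polynomials at the coarse point, Lagrange remainder -/

section Smooth

variable {m n : Type*} [Fintype n]

/-- [folklore] The row-wise Taylor matrix `X i j = Σ_{k ≤ p} f^{(k)}(a_i)/k! · y_j^k` has rank
`≤ p + 1` (bookkeeping: an instance of `rank_le_card_of_eq_sum_mul`). -/
private theorem rank_taylorMatrix_le (f : ℝ → ℝ) (p : ℕ) (a : m → ℝ) (y : n → ℝ) :
    (Matrix.of fun i j => ∑ k : Fin (p + 1),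
        ((k : ℕ)! : ℝ)⁻¹ * iteratedDeriv k f (a i) * y j ^ (k : ℕ)).rank ≤ p + 1 := by
  have h := rank_le_card_of_eq_sum_mul
    (Matrix.of fun i j => ∑ k : Fin (p + 1),
      ((k : ℕ)! : ℝ)⁻¹ * iteratedDeriv k f (a i) * y j ^ (k : ℕ))
    (fun i (k : Fin (p + 1)) => ((k : ℕ)! : ℝ)⁻¹ * iteratedDeriv k f (a i))
    (fun k j => y j ^ (k : ℕ)) fun _ _ => rfl
  simpa using h

omit [Fintype n] in
/-- [folklore] At offset `0` the row-wise Taylor matrix reproduces `f (a i)` (bookkeeping). -/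
private theorem taylorMatrix_apply_of_eq_zero (f : ℝ → ℝ) (p : ℕ) (a : m → ℝ) (y : n → ℝ)
    {i : m} {j : n} (hj : y j = 0) :
    (Matrix.of fun i j => ∑ k : Fin (p + 1),
        ((k : ℕ)! : ℝ)⁻¹ * iteratedDeriv k f (a i) * y j ^ (k : ℕ)) i j = f (a i) := by
  rw [Matrix.of_apply, Fin.sum_univ_succ, hj]
  simp

/-- THE SMOOTHNESS `(ε,∞)`-RANK BOUND (Taylor form).  Let the fine offsets satisfy
`y_j ∈ [0, η]` and let `f` be `C^{p+1}` at every point of every cell `[a_i, a_i + η]` with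
`|f^{(p+1)}| ≤ M` on the cells.  Then the two-scale matrix `(f(a_i + y_j))_{i,j}` is within
`M η^{p+1} / (p+1)!` of a matrix of rank `≤ p + 1`: the row-wise Taylor polynomials of degree `p`
at `a_i` all lie in the span of the `p + 1` fine-grid vectors `(y_j^k)_j`, and the Lagrange
remainder is `f^{(p+1)}(ξ) y_j^{p+1}/(p+1)!`.  This is [Lindsey2023, Prop. 2] with Taylor
expansion in the fine variable in place of Chebyshev–Lobatto interpolation (there:
`E_{m,N}[f] ≤ (4C/π) 2^{-m} / (p (N-p)^p)` and `(ε,∞)`-rank `≤ N + 1` via Lemma 1; here `N = p`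
and the interpolation error is replaced by the Taylor remainder `C η^{p+1}/(p+1)!`,
`η = 2^{-m}`), and the polynomial-approximation step of [Grasedyck2010, Thm. 18, proof step 1].
Rows near singularities of `f` are handled by `exists_rank_le_add_card_of_rows`.
[cite: Lindsey2023, Prop. 2 (Taylor variant) and Lemma 1]
[cite: Grasedyck2010, Thm. 18 (proof, step 1)] -/
theorem exists_rank_le_succ_of_contDiffAt (f : ℝ → ℝ) {p : ℕ} (a : m → ℝ) (y : n → ℝ)
    {η M : ℝ} (hy : ∀ j, y j ∈ Icc 0 η)
    (hf : ∀ i, ∀ x ∈ Icc (a i) (a i + η), ContDiffAt ℝ (p + 1) f x)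
    (hM : ∀ i, ∀ x ∈ Icc (a i) (a i + η), |iteratedDeriv (p + 1) f x| ≤ M) :
    ∃ X : Matrix m n ℝ, X.rank ≤ p + 1 ∧
      ∀ i j, |f (a i + y j) - X i j| ≤ M * η ^ (p + 1) / (p + 1)! := by
  refine ⟨Matrix.of fun i j => ∑ k : Fin (p + 1),
      ((k : ℕ)! : ℝ)⁻¹ * iteratedDeriv k f (a i) * y j ^ (k : ℕ),
    rank_taylorMatrix_le f p a y, fun i j => ?_⟩
  have hη : 0 ≤ η := (hy j).1.trans (hy j).2
  have hM0 : 0 ≤ M := (abs_nonneg _).trans (hM i (a i) ⟨le_rfl, by linarith⟩)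
  rcases (hy j).1.eq_or_lt with h0 | hpos
  · rw [taylorMatrix_apply_of_eq_zero f p a y h0.symm, ← h0, add_zero, sub_self, abs_zero]
    positivity
  · have hlt : a i < a i + y j := by linarith
    have hsub : Icc (a i) (a i + y j) ⊆ Icc (a i) (a i + η) :=
      Icc_subset_Icc_right (by linarith [(hy j).2])
    have hcd : ContDiffOn ℝ (p + 1) f (uIcc (a i) (a i + y j)) := by
      rw [uIcc_of_le hlt.le]
      exact fun z hz => (hf i z (hsub hz)).contDiffWithinAt
    obtain ⟨x', hx', hrem⟩ := taylor_mean_remainder_lagrange_iteratedDeriv hlt.ne hcd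
    have hT : taylorWithinEval f p (uIcc (a i) (a i + y j)) (a i) (a i + y j) =
        (Matrix.of fun i j => ∑ k : Fin (p + 1),
          ((k : ℕ)! : ℝ)⁻¹ * iteratedDeriv k f (a i) * y j ^ (k : ℕ)) i j := by
      rw [taylor_within_apply, Matrix.of_apply, Finset.sum_range (fun k =>
        (((k ! : ℝ)⁻¹ * (a i + y j - a i) ^ k) • iteratedDerivWithin k f
          (uIcc (a i) (a i + y j)) (a i)))]
      refine Finset.sum_congr rfl fun k _ => ?_
      rw [uIcc_of_le hlt.le, iteratedDerivWithin_eq_iteratedDeriv (uniqueDiffOn_Icc hlt)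
        ((hf i (a i) ⟨le_rfl, by linarith⟩).of_le (by exact_mod_cast (by omega : (k : ℕ) ≤ p + 1)))
        (left_mem_Icc.2 hlt.le), add_sub_cancel_left, smul_eq_mul]
      ring
    rw [← hT, hrem]
    rw [uIoo_of_le hlt.le] at hx'
    have hx'mem : x' ∈ Icc (a i) (a i + η) := hsub ⟨hx'.1.le, hx'.2.le⟩
    rw [add_sub_cancel_left, abs_div, abs_mul, abs_pow, abs_of_nonneg (hy j).1,
      Nat.abs_cast]
    gcongr
    · exact hM i x' hx'mem
    · exact (hy j).2

/-- Global-smoothness corollary: `f ∈ C^{p+1}(ℝ)` with `|f^{(p+1)}| ≤ M` on the cells and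
`y_j ∈ [0, η]` ⇒ `(f(a_i + y_j))` is within `M η^{p+1}/(p+1)!` of rank `≤ p + 1`; with
`η = b^{-m}` at QTT bond `m` the error decays like `b^{-m(p+1)}` ("the interpolation error …
controls the ranks of the unfolding matrices").
[cite: Lindsey2023, Prop. 2 (Taylor variant) and Lemma 1] -/
theorem exists_rank_le_succ_of_contDiff (f : ℝ → ℝ) {p : ℕ} (hf : ContDiff ℝ (p + 1) f)
    (a : m → ℝ) (y : n → ℝ) {η M : ℝ} (hy : ∀ j, y j ∈ Icc 0 η)
    (hM : ∀ i, ∀ x ∈ Icc (a i) (a i + η), |iteratedDeriv (p + 1) f x| ≤ M) :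
    ∃ X : Matrix m n ℝ, X.rank ≤ p + 1 ∧
      ∀ i j, |f (a i + y j) - X i j| ≤ M * η ^ (p + 1) / (p + 1)! :=
  exists_rank_le_succ_of_contDiffAt f a y hy (fun _ _ _ => hf.contDiffAt) hM

/-- TT-RANKS OF SAMPLED FUNCTIONS WITH SINGULARITIES — the assembled mechanism of
[Grasedyck2010, Thm. 18] ("rank `≤ p + 1 + 2m`"): Taylor-approximate the rows `i` with `P i`
(those whose cell `[a_i, a_i + η]` lies in the region where `f` is `C^{p+1}` with
`|f^{(p+1)}| ≤ M`) and keep every other row (the `≤ 2m` sub-vectors next to the `m` singular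
points) exact: `(f(a_i + y_j))` is within `M η^{p+1}/(p+1)!` of a matrix of rank
`≤ p + 1 + #{i | ¬ P i}`.  (The degree choice `p = C + log₂(1/ε)` and the asymptotic-smoothness
constants of [Grasedyck2010, Thm. 18] are not formalised.)
[cite: Grasedyck2010, Thm. 18 (proof, steps 1–2)] -/
theorem exists_rank_le_succ_add_card_of_contDiffAt [Fintype m] (f : ℝ → ℝ) {p : ℕ}
    (a : m → ℝ) (y : n → ℝ) {η M : ℝ} (hη : 0 ≤ η) (hM0 : 0 ≤ M) (hy : ∀ j, y j ∈ Icc 0 η)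
    (P : m → Prop) [DecidablePred P]
    (hf : ∀ i, P i → ∀ x ∈ Icc (a i) (a i + η), ContDiffAt ℝ (p + 1) f x)
    (hM : ∀ i, P i → ∀ x ∈ Icc (a i) (a i + η), |iteratedDeriv (p + 1) f x| ≤ M)
    (A : Matrix m n ℝ) (hA : ∀ i j, A i j = f (a i + y j)) :
    ∃ X : Matrix m n ℝ, X.rank ≤ p + 1 + Fintype.card {i // ¬ P i} ∧
      ∀ i j, |A i j - X i j| ≤ M * η ^ (p + 1) / (p + 1)! := by
  obtain ⟨X₀, hX₀, hX₀e⟩ := exists_rank_le_succ_of_contDiffAt f (fun i : {i // P i} => a i) y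
    hy (fun i => hf i i.2) (fun i => hM i i.2)
  exact exists_rank_le_add_card_of_rows A P (by positivity) X₀ hX₀ fun i j => by
    rw [hA]
    exact hX₀e i j

/-- THE EQUISPACED-GRID RESHAPE (quantics unfolding) OF A SMOOTH FUNCTION: for the samples
`v_s = f(x₀ + s δ)`, `s < M L`, of `f ∈ C^{p+1}` with `|f^{(p+1)}| ≤ M_f` on
`[x₀, x₀ + M L δ]`, the reshape `(i, j) ↦ v_{j + L i}` (rows = the `M` contiguous sub-vectors
of length `L`, [Grasedyck2010, Thm. 11]) is within `M_f (L δ)^{p+1} / (p+1)!` of a matrix of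
rank `≤ p + 1`.  For the base-`b` quantics tensor on `b^R` points (`δ = b^{-R}`) at bond `m`:
`M = b^m`, `L = b^{R-m}`, `L δ = b^{-m}` — the error bound decreases geometrically with the bond
index while the rank bound `p + 1` is uniform in the grid size.
[cite: Lindsey2023, Prop. 2 (Taylor variant) and Lemma 1]
[cite: Grasedyck2010, Thm. 11 and Thm. 18 (proof, step 1)] -/
theorem exists_rank_le_succ_reshape_of_contDiff {M L : ℕ} (f : ℝ → ℝ) {p : ℕ}
    (hf : ContDiff ℝ (p + 1) f) (x₀ δ : ℝ) (hδ : 0 ≤ δ) {Mf : ℝ}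
    (hM : ∀ x ∈ Icc x₀ (x₀ + (M : ℝ) * L * δ), |iteratedDeriv (p + 1) f x| ≤ Mf)
    (v : Fin (M * L) → ℝ) (hv : ∀ s, v s = f (x₀ + (s : ℕ) * δ)) :
    ∃ X : Matrix (Fin M) (Fin L) ℝ, X.rank ≤ p + 1 ∧
      ∀ i j, |(Matrix.of fun (i : Fin M) (j : Fin L) => v (finProdFinEquiv (i, j))) i j - X i j|
        ≤ Mf * ((L : ℝ) * δ) ^ (p + 1) / (p + 1)! := by
  have hy : ∀ j : Fin L, ((j : ℕ) : ℝ) * δ ∈ Icc 0 ((L : ℝ) * δ) := fun j =>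
    ⟨by positivity, by gcongr; exact_mod_cast j.2.le⟩
  have hcell : ∀ i : Fin M, ∀ x ∈ Icc (x₀ + (L : ℝ) * (i : ℕ) * δ) (x₀ + (L : ℝ) * (i : ℕ) * δ +
      (L : ℝ) * δ), |iteratedDeriv (p + 1) f x| ≤ Mf := by
    intro i x hx
    have hLi : 0 ≤ (L : ℝ) * (i : ℕ) * δ := by positivity
    have hLδ : 0 ≤ (L : ℝ) * δ := by positivity
    have hi : ((i : ℕ) : ℝ) + 1 ≤ M := by exact_mod_cast Nat.succ_le_of_lt i.2
    refine hM x ⟨by linarith [hx.1], ?_⟩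
    nlinarith [hLδ, hi, hx.2]
  obtain ⟨X, hX, hXe⟩ := exists_rank_le_succ_of_contDiff f hf
    (fun i : Fin M => x₀ + (L : ℝ) * (i : ℕ) * δ) (fun j : Fin L => ((j : ℕ) : ℝ) * δ) hy hcell
  refine ⟨X, hX, fun i j => ?_⟩
  have hpt : x₀ + (L : ℝ) * (i : ℕ) * δ + ((j : ℕ) : ℝ) * δ =
      x₀ + (((finProdFinEquiv (i, j) : Fin (M * L)) : ℕ) : ℝ) * δ := by
    rw [finProdFinEquiv_apply_val]
    push_cast
    ring
  rw [Matrix.of_apply, hv, ← hpt]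
  exact hXe i j

end Smooth

/-! ## Digit-string form (the shape of `TCIPivots.unfolding`) -/

section Digits

variable {σ : Type*} [Fintype σ] {ℓ ℓ' : ℕ}

/-- DIGIT-STRING FORM OF THE SMOOTHNESS BOUND.  A quantized tensor representation
`F = f ∘ pt` of `f` on digit strings whose point map is SELF-SIMILAR across the bond,
`pt (x ++ y) = pt x + θ · pt y` with `pt y ∈ [0, c]` for the fine strings `y` (base-`b` digits,
most significant first: `θ = b^{-ℓ}`, `c < 1`; [Lindsey2023, §3.1]: the `m`-th unfolding has
entries `f(u + 2^{-m} v)`, `u ∈ D_m ⊂ [0, 1 - 2^{-m}]`, `v ∈ D_{K-m} ⊂ [0, 1]`), has its bond-`ℓ`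
unfolding `(x, y) ↦ F (x ++ y)` — literally `TCIPivots.unfolding_apply` of
`TensorCrossExactRecovery` — within `M (θ c)^{p+1}/(p+1)!` of rank `≤ p + 1` whenever `f` is
`C^{p+1}` with `|f^{(p+1)}| ≤ M` near the cells `[pt x, pt x + θ c]`.  This discharges the
hypothesis `hlow` of `TCIPivots.abs_sub_tciEval_le_of_unfoldings_volume_maximal` for smooth `f`.
[cite: Lindsey2023, Lemma 1 and Prop. 2 (Taylor variant)] -/
theorem exists_rank_le_succ_of_contDiffAt_append (f : ℝ → ℝ) {p : ℕ} (pt : List σ → ℝ)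
    {θ c M : ℝ} (hθ : 0 ≤ θ)
    (hsplit : ∀ (x : List.Vector σ ℓ) (y : List.Vector σ ℓ'),
      pt (x.1 ++ y.1) = pt x.1 + θ * pt y.1)
    (hrange : ∀ y : List.Vector σ ℓ', pt y.1 ∈ Icc 0 c)
    (hf : ∀ x : List.Vector σ ℓ, ∀ z ∈ Icc (pt x.1) (pt x.1 + θ * c), ContDiffAt ℝ (p + 1) f z)
    (hM : ∀ x : List.Vector σ ℓ, ∀ z ∈ Icc (pt x.1) (pt x.1 + θ * c),
      |iteratedDeriv (p + 1) f z| ≤ M) :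
    ∃ X : Matrix (List.Vector σ ℓ) (List.Vector σ ℓ') ℝ, X.rank ≤ p + 1 ∧
      ∀ x y, |f (pt (x.1 ++ y.1)) - X x y| ≤ M * (θ * c) ^ (p + 1) / (p + 1)! := by
  have hy : ∀ y : List.Vector σ ℓ', θ * pt y.1 ∈ Icc 0 (θ * c) := fun y =>
    ⟨mul_nonneg hθ (hrange y).1, mul_le_mul_of_nonneg_left (hrange y).2 hθ⟩
  obtain ⟨X, hX, hXe⟩ := exists_rank_le_succ_of_contDiffAt f
    (fun x : List.Vector σ ℓ => pt x.1) (fun y : List.Vector σ ℓ' => θ * pt y.1) hy hf hM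
  exact ⟨X, hX, fun x y => by rw [hsplit]; exact hXe x y⟩

end Digits

/-! ## Consequence for maximal-volume cross interpolation of smooth two-scale matrices -/

section Cross

variable {m n ι : Type*} [Fintype n] [Fintype ι] [DecidableEq ι]

/-- A-PRIORI ERROR OF MAXIMAL-VOLUME CROSS INTERPOLATION OF A SMOOTH TWO-SCALE MATRIX: if
`A i j = f (a i + y j)` with `y_j ∈ [0, η]`, `f ∈ C^{p+1}` near the cells with `|f^{(p+1)}| ≤ M`,
and the `#ι ≥ p + 1` pivots `(r, c)` have a nonsingular pivot block of maximal volume, then every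
entry of `A - A[:,J] A[I,J]⁻¹ A[I,:]` is at most `(#ι + 1)² · M η^{p+1}/(p+1)!` — the
smoothness `(ε,∞)`-rank bound `exists_rank_le_succ_of_contDiffAt` fed into the Chebyshev-norm
quasi-optimality `(r+1)² · min_{rank F ≤ r} ‖A - F‖_C` of maximal-volume skeletons
(`Literature.LinearAlgebra.Matrix.abs_sub_crossInterp_le_of_volume_maximal`).
[cite: Lindsey2023, Prop. 2 (Taylor variant) and Lemma 1][cite: Savostyanov2014, §2 eq. (6)] -/
theorem abs_sub_crossInterp_le_of_contDiffAt_of_volume_maximal (f : ℝ → ℝ) {p : ℕ}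
    (a : m → ℝ) (y : n → ℝ) {η M : ℝ} (hy : ∀ j, y j ∈ Icc 0 η)
    (hf : ∀ i, ∀ x ∈ Icc (a i) (a i + η), ContDiffAt ℝ (p + 1) f x)
    (hM : ∀ i, ∀ x ∈ Icc (a i) (a i + η), |iteratedDeriv (p + 1) f x| ≤ M)
    (A : Matrix m n ℝ) (hA : ∀ i j, A i j = f (a i + y j)) (r : ι → m) (c : ι → n)
    (hcard : p + 1 ≤ Fintype.card ι) (hP : IsUnit (A.submatrix r c).det)
    (hmax : ∀ (r' : ι → m) (c' : ι → n), |(A.submatrix r' c').det| ≤ |(A.submatrix r c).det|)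
    (i : m) (j : n) :
    |(A - Literature.LinearAlgebra.Matrix.crossInterp A r c) i j| ≤
      (Fintype.card ι + 1 : ℝ) ^ 2 * (M * η ^ (p + 1) / (p + 1)!) := by
  obtain ⟨X, hX, hXe⟩ := exists_rank_le_succ_of_contDiffAt f a y hy hf hM
  exact Literature.LinearAlgebra.Matrix.abs_sub_crossInterp_le_of_volume_maximal A r c hP hmax
    X (hX.trans hcard) (fun i j => by rw [hA]; exact hXe i j) i j

end Cross

end Literature.LinearAlgebra.TensorNetworks
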